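import Literature.Topology.FourManifolds.SPC4HandlesNormHolds
import Literature.Topology.FourManifolds.SPC4HandlesGeneratingSets
import Literature.Topology.FourManifolds.OneHandlebodyBoundaryFundamentalGroup
import HarnessLib

/-!
# Laudenbach–Poénaru's Lemma 2 without the classification: h₁ from realisations on every
# decomposed `1`-handlebody

Topic `Literature/Topology/FourManifolds`; fact seat
`provefact-Literature.Topology.FourManifolds.laudenbachPoenaru_exists_diffeoExtends_mapOfEq_eq`
(h₁ of `SPC4HandlesProofs.lean`: every automorphism of `π₁(∂V, z₀)` of a compact connected
orientable `4`-dimensional `1`-handlebody `V` is induced by a based self-diffeomorphism of `∂V`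
that extends over `V`; Laudenbach–Poénaru (1972), Lemma 2, "`B` is surjective", pp. 339–340).
Everything here is **proved**; no definition of a named fact is introduced.

The tree's reduction of h₁ (`laudenbachPoenaru_exists_diffeoExtends_mapOfEq_eq_of_model`,
`…_of_nielsen`, `…_of_oneHandle_of_realise`) goes through **one model** `Y_p` per `p` and the
classification UNIQ₄ of orientable `4`-dimensional `1`-handlebodies (hence through L1,
`oneHandle_nonempty_diffeomorph`).  The paper, however, proves Lemma 2 on `Y_p` only because
`Y_p` *is* the general `V` up to diffeomorphism; its constructions — "The construction of `H₁`,
`H₂` is an elementary exercise. In order to define `H₃` … we can slide the handle `D¹₁ × D³₁`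
along `D¹₂ × D³₂`" (p. 340) — use nothing but a handle decomposition
`Y_p = A + (φ₁) + ⋯ + (φ_p)` with one `0`-handle.  In the Morse-theoretic vocabulary of this tree
(`HasHandleDecomposition 3 V (handleCount 1 k)`: an adapted Morse function with one critical
point of index `0` and `k` of index `1`) such a decomposition exists on **every** compact
connected `4`-dimensional `1`-handlebody `V` by the discharged normal form NORM
(`exists_hasHandleDecomposition_handleCount_one_holds`, `SPC4HandlesNormHolds.lean`), and the
slides can be performed on `V` itself (rearrangement of the critical values, Milnor 1965 §4;
a diffeotopy of the level below the top `1`-handle dragging one of its feet; the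
handle-extension map of `HandleConjugation.lean`).  This file records the corresponding
**model-free** reduction, which removes L1/UNIQ₄ from the dependencies of h₁:

* `laudenbachPoenaru_lemma2_transport` (§1): Lemma 2 at one boundary datum and base point of
  `V₀` transports along any diffeomorphism `φ : V ≅ V₀` to every boundary datum and base point
  of `V` (the body of `laudenbachPoenaru_exists_diffeoExtends_mapOfEq_eq_of_model`, with the
  diffeomorphism as a parameter; used below with `φ = id`).
* §2, the `π₁` bookkeeping between a boundary datum `b` and `V`: the homomorphism
  `(b.incl)_# : π₁(b.carrier, z) → π₁(V, b.incl z)` (`BoundaryData.inclFundamentalGroupHom`) is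
  natural with respect to the restriction `∂G` of a self-diffeomorphism `G` of `V`
  (`BoundaryData.inclFundamentalGroupHom_restrictDiffeomorph`) and bijective when `V` is a
  `4`-dimensional `1`-handlebody with one `0`-handle
  (`HasHandleDecomposition.bijective_inclFundamentalGroupHom`, from
  `HasHandleDecomposition.bijective_inclHom_boundary`, `OneHandlebodyBoundaryFundamentalGroup.lean`);
  hence a based self-diffeomorphism `G` of `V` realising `e⁻¹ ν e` on `π₁(V, b.incl z)` restricts
  to an extendable based self-diffeomorphism of `b.carrier` realising the same automorphism
  transported to `π₁(b.carrier, z)` (`BoundaryData.isRealisedByExtendable_of_diffeomorph`).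
* `laudenbachPoenaru_exists_diffeoExtends_mapOfEq_eq_of_forall_realise` (§3): **h₁ holds as
  soon as, for every `k` and every compact connected orientable `V` with
  `HasHandleDecomposition 3 V (handleCount 1 k)`, some boundary point `z`, some isomorphism
  `e : π₁(V, z) ≅ F_k` and some generating set `S` of `Aut F_k` have every `e⁻¹ ν e`, `ν ∈ S`,
  induced by a self-diffeomorphism of `V` fixing `z`** — with the corollary
  `…_of_forall_realise_nielsen` for `S =` the elementary Nielsen automorphisms `xᵢ ↦ xᵢ⁻¹`,
  `xᵢ ↦ xᵢ xⱼ` (`nielsenGenerators k`, Nielsen's theorem being proved in the tree,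
  `autFreeGroup_eq_closure_nielsen_holds`), which are exactly the moves realised handle by
  handle ("flip the feet of handle `i`", "slide a foot of handle `i`
  over handle `j`"), and the boundary form `…_of_forall_realise_boundary` (realisations given on
  some boundary datum of each `V`, as in REALISE).

## References

* F. Laudenbach, V. Poénaru, *A note on 4-dimensional handlebodies*, Bull. Soc. Math. France
  100 (1972), 337–344: §2, Lemma 2 and its proof (pp. 339–340). [LaudenbachPoenaruBSMF1972]
* J. Milnor, *Lectures on the h-cobordism theorem* (1965), §4 (rearrangement), Thm. 3.13.
  [MilnorHCobordism1965]
* A. Hatcher, *Algebraic Topology* (2002), §1.1 (functoriality of `π₁`), Prop. 1.26. [HatcherAT2002]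
* D. L. Johnson, *Presentations of Groups* (1997), Ch. 3 §4, Cor. 7 (Nielsen's generators).
  [Johnson1997]
-/

open scoped Manifold ContDiff Topology
open Set Function

noncomputable section

namespace Literature.Topology.FourManifolds

open Literature.AlgebraicTopology Literature.AlgebraicTopology.FundamentalGroup

universe u

/-! ### §1 Transport of Lemma 2 along a diffeomorphism -/

section Transport

variable {V : Type u} [TopologicalSpace V] [ChartedSpace (EuclideanHalfSpace 4) V]
  {V₀ : Type u} [TopologicalSpace V₀] [T2Space V₀] [SecondCountableTopology V₀]
  [CompactSpace V₀] [ChartedSpace (EuclideanHalfSpace 4) V₀] [IsManifold (𝓡∂ 4) ∞ V₀]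

/-- **Lemma 2 transports along diffeomorphisms, to every boundary datum and base point.**  Let
`φ : V ≅ V₀` be a diffeomorphism onto a compact smooth `4`-manifold with boundary, `b₀` a boundary
datum of `V₀` with connected carrier and `z₀ ∈ b₀.carrier` a base point at which every
automorphism of `π₁(b₀.carrier, z₀)` is induced by an extendable based self-diffeomorphism of
`b₀.carrier`.  Then the same holds at every boundary datum `b` of `V` and every `z ∈ b.carrier`:
with `ψ = ∂φ : b.carrier ≅ b₀.carrier` and `P₀` diffeotopic to the identity with
`P₀ (ψ z) = z₀` (homogeneity, `Homogeneity.lean`; `P₀` extends over `V₀` by the discharged collar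
fact `BoundaryData.diffeoExtends_of_isDiffeotopicToId_holds`), realise `e_# θ e_#⁻¹`,
`e = P₀ ∘ ψ`, by `χ₀` and take `χ = e⁻¹ ∘ χ₀ ∘ e` (`FundamentalGroup.mapOfEq_conj`,
`BoundaryData.DiffeoExtends.conj`).  This is the argument of
`laudenbachPoenaru_exists_diffeoExtends_mapOfEq_eq_of_model` with the diffeomorphism as a
parameter. [cite: LaudenbachPoenaruBSMF1972, Lemma 2 (pp. 339–340)] -/
theorem laudenbachPoenaru_lemma2_transport (φ : V ≃ₘ⟮𝓡∂ 4, 𝓡∂ 4⟯ V₀)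
    (b₀ : BoundaryData (𝓡∂ 4) V₀ (𝓡 3)) [ConnectedSpace b₀.carrier] (z₀ : b₀.carrier)
    (hL₀ : ∀ θ₀ : FundamentalGroup b₀.carrier z₀ ≃* FundamentalGroup b₀.carrier z₀,
      ∃ χ₀ : b₀.carrier ≃ₘ⟮𝓡 3, 𝓡 3⟯ b₀.carrier, b₀.DiffeoExtends χ₀ ∧ ∃ hz : χ₀ z₀ = z₀,
        ∀ a : FundamentalGroup b₀.carrier z₀,
          FundamentalGroup.mapOfEq (⟨χ₀, χ₀.continuous⟩ : C(b₀.carrier, b₀.carrier)) hz a = θ₀ a)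
    (b : BoundaryData (𝓡∂ 4) V (𝓡 3)) (z : b.carrier)
    (θ : FundamentalGroup b.carrier z ≃* FundamentalGroup b.carrier z) :
    ∃ χ : b.carrier ≃ₘ⟮𝓡 3, 𝓡 3⟯ b.carrier, b.DiffeoExtends χ ∧ ∃ hz : χ z = z,
      ∀ a : FundamentalGroup b.carrier z,
        FundamentalGroup.mapOfEq (⟨χ, χ.continuous⟩ : C(b.carrier, b.carrier)) hz a = θ a := by
  haveI : T2Space b₀.carrier := b₀.isSmoothEmbedding.isEmbedding.t2Space
  set ψ := b.restrictDiffeomorph b₀ φ with hψ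
  -- move `ψ z` to the base point `z₀`
  obtain ⟨P₀, hP₀iso, hP₀z⟩ :=
    Diffeomorph.exists_isDiffeotopicToId_apply_eq_euclidean 3 b₀.carrier (ψ z) z₀
  have hP₀ext : b₀.DiffeoExtends P₀ :=
    BoundaryData.diffeoExtends_of_isDiffeotopicToId_holds 3 V₀ b₀ P₀ hP₀iso
  set e := ψ.trans P₀ with he
  have hez : e.toHomeomorph z = z₀ := by simp [he, Diffeomorph.coe_trans, hP₀z]
  set eπ := Homeomorph.fundamentalGroupCongr e.toHomeomorph hez with heπ
  -- realise the transported automorphism at `(b₀, z₀)`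
  obtain ⟨χ₀, hχ₀ext, hχ₀z, hχ₀π⟩ := hL₀ (eπ.symm.trans (θ.trans eπ))
  have hPz' : P₀.symm z₀ = ψ z := by rw [← hP₀z, Diffeomorph.symm_apply_apply]
  have hfix : ((ψ.trans ((P₀.trans χ₀).trans P₀.symm)).trans ψ.symm) z = z := by
    simp [Diffeomorph.coe_trans, hP₀z, hχ₀z, hPz']
  refine ⟨(ψ.trans ((P₀.trans χ₀).trans P₀.symm)).trans ψ.symm,
    ((hP₀ext.trans hχ₀ext).trans hP₀ext.symm).conj φ, hfix, fun a => ?_⟩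
  have key := FundamentalGroup.mapOfEq_conj e.toHomeomorph hez
    (⟨_, ((ψ.trans ((P₀.trans χ₀).trans P₀.symm)).trans ψ.symm).continuous⟩ :
      C(b.carrier, b.carrier))
    (⟨χ₀, χ₀.continuous⟩ : C(b₀.carrier, b₀.carrier)) hfix hχ₀z
    (fun p => by simp [he, Diffeomorph.coe_trans]) a
  -- `key : (eπ⁻¹; θ; eπ) (eπ a) = eπ (χ_# a)`
  rw [hχ₀π, ← heπ, MulEquiv.trans_apply, MulEquiv.trans_apply, MulEquiv.symm_apply_apply] at key
  exact (eπ.injective key).symm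

end Transport

/-! ### §2 `π₁` of a boundary datum and of the manifold -/

section Incl

variable {V : Type u} [TopologicalSpace V] [ChartedSpace (EuclideanHalfSpace 4) V]
  (b : BoundaryData (𝓡∂ 4) V (𝓡 3))

/-- The inclusion of a boundary datum as a continuous map `b.carrier → V`. [folklore] -/
abbrev BoundaryData.inclCM : C(b.carrier, V) := ⟨b.incl, b.continuous_incl⟩

/-- **`(b.incl)_# : π₁(b.carrier, z) → π₁(V, b.incl z)`**, the homomorphism induced on
fundamental groups by the inclusion of a boundary datum (Hatcher (2002), §1.1). [folklore] -/
def BoundaryData.inclFundamentalGroupHom (z : b.carrier) :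
    FundamentalGroup b.carrier z →* FundamentalGroup V (b.incl z) :=
  FundamentalGroup.mapOfEq b.inclCM rfl

/-- Unfolding lemma for `BoundaryData.inclFundamentalGroupHom`. [folklore] -/
theorem BoundaryData.inclFundamentalGroupHom_apply (z : b.carrier) (a : FundamentalGroup b.carrier z) :
    b.inclFundamentalGroupHom z a = FundamentalGroup.mapOfEq b.inclCM rfl a :=
  rfl

/-- The carrier of a boundary datum is homeomorphic to the boundary `∂V ⊆ V` (as a subspace),
by `b.incl` (an embedding with image `∂V`). [folklore] -/
def BoundaryData.homeomorphBoundary : b.carrier ≃ₜ ((𝓡∂ 4).boundary V) :=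
  b.isSmoothEmbedding.isEmbedding.toHomeomorph.trans (Homeomorph.setCongr b.range_incl)

/-- `BoundaryData.homeomorphBoundary` is `b.incl` with values in the subtype `∂V`. [folklore] -/
@[simp]
theorem BoundaryData.coe_homeomorphBoundary_apply (w : b.carrier) :
    (b.homeomorphBoundary w : V) = b.incl w := by
  simp [BoundaryData.homeomorphBoundary, Topology.IsEmbedding.toHomeomorph, Homeomorph.setCongr]

/-- **Factorisation of `(b.incl)_#` through the boundary subspace**:
`(b.incl)_# = i_# ∘ (homeomorphism b.carrier ≅ ∂V)_#`, `i : ∂V ↪ V`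
(functoriality, Hatcher (2002), §1.1). [folklore] -/
theorem BoundaryData.inclFundamentalGroupHom_eq_inclHom_comp (z : b.carrier)
    (a : FundamentalGroup b.carrier z) :
    b.inclFundamentalGroupHom z a =
      VanKampen.inclHom ((𝓡∂ 4).boundary V) (b.incl z) (b.incl_mem_boundary z)
        (Homeomorph.fundamentalGroupCongr b.homeomorphBoundary
          (Subtype.ext (b.coe_homeomorphBoundary_apply z)) a) := by
  rw [BoundaryData.inclFundamentalGroupHom_apply, Homeomorph.fundamentalGroupCongr_apply,
    VanKampen.inclHom, ← FundamentalGroup.mapOfEq_comp_apply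
      (b.homeomorphBoundary : C(b.carrier, (𝓡∂ 4).boundary V))
      (VanKampen.incl ((𝓡∂ 4).boundary V)) (Subtype.ext (b.coe_homeomorphBoundary_apply z)) rfl a]
  exact FundamentalGroup.mapOfEq_congr
    (ContinuousMap.ext fun w => (b.coe_homeomorphBoundary_apply w).symm) _ a

/-- **`π₁(b.carrier) ≅ π₁(V)` for a `4`-dimensional `1`-handlebody with one `0`-handle**: if the
compact connected `V` has a handle decomposition with one `0`-handle, `k` `1`-handles and no
other handles, then `(b.incl)_# : π₁(b.carrier, z) → π₁(V, b.incl z)` is bijective for every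
boundary datum `b` and every `z` — `π₁(#ᵏ(S¹ × S²)) ≅ π₁(♮ᵏ(S¹ × B³))`, i.e. Laudenbach–Poénaru's
"`i_# : π₁ ∂Y_p → π₁ Y_p` is bijective" (p. 339); by
`HasHandleDecomposition.bijective_inclHom_boundary` (Milnor's dual handles of dimension `≥ 3`,
Hatcher's Prop. 1.26) and the factorisation above.
[cite: LaudenbachPoenaruBSMF1972, §2, p. 339] [cite: HatcherAT2002, Prop. 1.26] -/
theorem HasHandleDecomposition.bijective_inclFundamentalGroupHom
    [T2Space V] [SecondCountableTopology V] [CompactSpace V] [ConnectedSpace V]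
    [IsManifold (𝓡∂ 4) ∞ V] {k : ℕ} (hk : HasHandleDecomposition 3 V (handleCount 1 k))
    (z : b.carrier) : Bijective (b.inclFundamentalGroupHom z) := by
  have hbij := HasHandleDecomposition.bijective_inclHom_boundary (n := 3) hk (handleCount_zero 1 k)
    (fun j hj => handleCount_of_two_le 1 k hj) le_rfl (b.incl_mem_boundary z)
  have hfun : ⇑(b.inclFundamentalGroupHom z) =
      ⇑(VanKampen.inclHom ((𝓡∂ 4).boundary V) (b.incl z) (b.incl_mem_boundary z)) ∘
        ⇑(Homeomorph.fundamentalGroupCongr b.homeomorphBoundary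
          (Subtype.ext (b.coe_homeomorphBoundary_apply z))) :=
    funext fun a => b.inclFundamentalGroupHom_eq_inclHom_comp z a
  rw [hfun]
  exact hbij.comp (MulEquiv.bijective _)

/-- **`π₁(b.carrier, z) ≅ π₁(V, b.incl z)` as an isomorphism**, for a `4`-dimensional
`1`-handlebody with one `0`-handle (`MulEquiv.ofBijective` on
`HasHandleDecomposition.bijective_inclFundamentalGroupHom`). [cite: LaudenbachPoenaruBSMF1972, §2, p. 339] -/
def HasHandleDecomposition.inclFundamentalGroupEquiv
    [T2Space V] [SecondCountableTopology V] [CompactSpace V] [ConnectedSpace V]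
    [IsManifold (𝓡∂ 4) ∞ V] {k : ℕ} (hk : HasHandleDecomposition 3 V (handleCount 1 k))
    (z : b.carrier) : FundamentalGroup b.carrier z ≃* FundamentalGroup V (b.incl z) :=
  MulEquiv.ofBijective (b.inclFundamentalGroupHom z) (hk.bijective_inclFundamentalGroupHom b z)

/-- Unfolding lemma for `HasHandleDecomposition.inclFundamentalGroupEquiv`. [folklore] -/
@[simp]
theorem HasHandleDecomposition.inclFundamentalGroupEquiv_apply
    [T2Space V] [SecondCountableTopology V] [CompactSpace V] [ConnectedSpace V]
    [IsManifold (𝓡∂ 4) ∞ V] {k : ℕ} (hk : HasHandleDecomposition 3 V (handleCount 1 k))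
    (z : b.carrier) (a : FundamentalGroup b.carrier z) :
    hk.inclFundamentalGroupEquiv b z a = b.inclFundamentalGroupHom z a :=
  rfl

/-- **Naturality of `(b.incl)_#` with respect to restriction to the boundary**: for a
self-diffeomorphism `G` of `V` with restriction `∂G = b.restrictDiffeomorph b G` to the boundary
datum (so `b.incl ∘ ∂G = G ∘ b.incl`) and a point `z` with `∂G z = z`, `G (b.incl z) = b.incl z`
and `(b.incl)_# ∘ (∂G)_# = G_# ∘ (b.incl)_#` on `π₁(b.carrier, z)` (Hatcher (2002), §1.1).
[folklore] -/
theorem BoundaryData.inclFundamentalGroupHom_restrictDiffeomorph (G : V ≃ₘ⟮𝓡∂ 4, 𝓡∂ 4⟯ V)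
    {z : b.carrier} (hz : b.restrictDiffeomorph b G z = z) (hGz : G (b.incl z) = b.incl z)
    (a : FundamentalGroup b.carrier z) :
    b.inclFundamentalGroupHom z
        (FundamentalGroup.mapOfEq
          (⟨b.restrictDiffeomorph b G, (b.restrictDiffeomorph b G).continuous⟩ :
            C(b.carrier, b.carrier)) hz a) =
      FundamentalGroup.mapOfEq (⟨G, G.continuous⟩ : C(V, V)) hGz (b.inclFundamentalGroupHom z a) := by
  rw [BoundaryData.inclFundamentalGroupHom_apply, BoundaryData.inclFundamentalGroupHom_apply,
    ← FundamentalGroup.mapOfEq_comp_apply _ b.inclCM hz rfl a,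
    ← FundamentalGroup.mapOfEq_comp_apply b.inclCM (⟨G, G.continuous⟩ : C(V, V)) rfl hGz a]
  exact FundamentalGroup.mapOfEq_congr
    (ContinuousMap.ext fun w => BoundaryData.incl_restrictDiffeomorph (b₁ := b) (b₂ := b) G w) _ a

/-- The restriction `∂G` of a self-diffeomorphism `G` of `V` to a boundary datum extends over `V`
(by `G`). [folklore] -/
theorem BoundaryData.diffeoExtends_restrictDiffeomorph (G : V ≃ₘ⟮𝓡∂ 4, 𝓡∂ 4⟯ V) :
    b.DiffeoExtends (b.restrictDiffeomorph b G) :=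
  ⟨G, funext fun w => (BoundaryData.incl_restrictDiffeomorph (b₁ := b) (b₂ := b) G w).symm⟩

/-- A self-diffeomorphism `G` of `V` fixing `b.incl z` restricts to a self-diffeomorphism of the
boundary datum fixing `z` (injectivity of `b.incl`). [folklore] -/
theorem BoundaryData.restrictDiffeomorph_apply_eq_self (G : V ≃ₘ⟮𝓡∂ 4, 𝓡∂ 4⟯ V) {z : b.carrier}
    (hGz : G (b.incl z) = b.incl z) : b.restrictDiffeomorph b G z = z :=
  b.injective_incl (by rw [BoundaryData.incl_restrictDiffeomorph (b₁ := b) (b₂ := b) G z, hGz])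

/-- **From a based self-diffeomorphism of `V` to a realisation on the boundary.**  Let `V` be a
compact connected `4`-dimensional `1`-handlebody with one `0`-handle, `b` a boundary datum,
`z ∈ b.carrier`, `ε = (b.incl)_# : π₁(b.carrier, z) ≅ π₁(V, b.incl z)`.  If a
self-diffeomorphism `G` of `V` fixes `b.incl z` and induces `Θ` on `π₁(V, b.incl z)`, then
`ε⁻¹ ∘ Θ ∘ ε` is realised by an extendable based self-diffeomorphism of `b.carrier`, namely by
`∂G` (`BoundaryData.IsRealisedByExtendable`; Laudenbach–Poénaru's passage from
`A : Diff Y_p → Aut π₁(Y_p)` to `B : Diff Y_p → Aut π₁(∂Y_p)` through "`i_#` is bijective",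
p. 339). [cite: LaudenbachPoenaruBSMF1972, §2, p. 339] -/
theorem BoundaryData.isRealisedByExtendable_of_diffeomorph
    [T2Space V] [SecondCountableTopology V] [CompactSpace V] [ConnectedSpace V]
    [IsManifold (𝓡∂ 4) ∞ V] {k : ℕ} (hk : HasHandleDecomposition 3 V (handleCount 1 k))
    {z : b.carrier} (G : V ≃ₘ⟮𝓡∂ 4, 𝓡∂ 4⟯ V) (hGz : G (b.incl z) = b.incl z)
    {Θ : FundamentalGroup V (b.incl z) → FundamentalGroup V (b.incl z)}
    (hG : ∀ c : FundamentalGroup V (b.incl z),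
      FundamentalGroup.mapOfEq (⟨G, G.continuous⟩ : C(V, V)) hGz c = Θ c) :
    b.IsRealisedByExtendable z (fun a =>
      (hk.inclFundamentalGroupEquiv b z).symm (Θ (hk.inclFundamentalGroupEquiv b z a))) := by
  refine ⟨b.restrictDiffeomorph b G, b.diffeoExtends_restrictDiffeomorph G,
    b.restrictDiffeomorph_apply_eq_self G hGz, fun a => ?_⟩
  rw [MulEquiv.eq_symm_apply, HasHandleDecomposition.inclFundamentalGroupEquiv_apply,
    HasHandleDecomposition.inclFundamentalGroupEquiv_apply,
    b.inclFundamentalGroupHom_restrictDiffeomorph G _ hGz, hG]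

end Incl

/-! ### §3 h₁ from realisations on every decomposed `1`-handlebody -/

section Direct

/-- **Lemma 2 at one boundary datum and base point, from realised generators on `V`.**  Let `V`
be a compact connected `4`-dimensional `1`-handlebody with one `0`-handle and `k` `1`-handles,
`b` a boundary datum, `z ∈ b.carrier`, `e : π₁(V, b.incl z) ≅ F_k`, and `S` a generating set of
`Aut F_k` such that every `e⁻¹ ν e`, `ν ∈ S`, is induced by a self-diffeomorphism of `V` fixing
`b.incl z`.  Then every automorphism of `π₁(b.carrier, z)` is induced by an extendable based
self-diffeomorphism of `b.carrier` ("it suffices to exhibit diffeomorphisms `Hᵢ : (Y_p, x₀) →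
(Y_p, x₀)` such that `(Hᵢ)_# = Φᵢ`", p. 339: realised automorphisms form a subgroup,
`BoundaryData.forall_isRealisedByExtendable_of_closure_eq_top_freeGroup`, and `i_#` is
bijective, §2). [cite: LaudenbachPoenaruBSMF1972, §2, Lemma 2 and its proof (p. 339)] -/
theorem forall_isRealisedByExtendable_of_realise_diffeomorph
    {V : Type u} [TopologicalSpace V] [T2Space V] [SecondCountableTopology V] [CompactSpace V]
    [ConnectedSpace V] [ChartedSpace (EuclideanHalfSpace 4) V] [IsManifold (𝓡∂ 4) ∞ V]
    {k : ℕ} (hk : HasHandleDecomposition 3 V (handleCount 1 k))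
    (b : BoundaryData (𝓡∂ 4) V (𝓡 3)) (z : b.carrier)
    (e : FundamentalGroup V (b.incl z) ≃* FreeGroup (Fin k))
    {S : Set (MulAut (FreeGroup (Fin k)))} (hS : Subgroup.closure S = ⊤)
    (hreal : ∀ ν ∈ S, ∃ (G : V ≃ₘ⟮𝓡∂ 4, 𝓡∂ 4⟯ V) (hGz : G (b.incl z) = b.incl z),
      ∀ c : FundamentalGroup V (b.incl z),
        FundamentalGroup.mapOfEq (⟨G, G.continuous⟩ : C(V, V)) hGz c = e.symm (ν (e c)))
    (θ : MulAut (FundamentalGroup b.carrier z)) : b.IsRealisedByExtendable z θ := by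
  set ε := hk.inclFundamentalGroupEquiv b z with hε
  refine BoundaryData.forall_isRealisedByExtendable_of_closure_eq_top_freeGroup (ε.trans e) hS
    (fun ν hν => ?_) θ
  obtain ⟨G, hGz, hG⟩ := hreal ν hν
  exact (b.isRealisedByExtendable_of_diffeomorph hk G hGz hG).congr fun a => by
    simp [hε, MulEquiv.trans_apply, MulEquiv.symm_trans_apply]

/-- **h₁ without the classification of `1`-handlebodies.**  Laudenbach–Poénaru's Lemma 2 for
every compact connected orientable `4`-dimensional `1`-handlebody
(`laudenbachPoenaru_exists_diffeoExtends_mapOfEq_eq`, `SPC4HandlesProofs.lean`) holds as soon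
as: for every `k` and every compact connected orientable smooth `4`-manifold with boundary `V`
with a handle decomposition with one `0`-handle and `k` `1`-handles, there are a boundary point
`z ∈ ∂V`, an isomorphism `e : π₁(V, z) ≅ F_k` and a generating set `S` of `Aut F_k` such that
every `e⁻¹ ν e`, `ν ∈ S`, is induced by a self-diffeomorphism of `V` fixing `z` — the paper's
`Hᵢ : (Y_p, x₀) → (Y_p, x₀)` with `(Hᵢ)_# = Φᵢ` (p. 339), constructed on `V` itself rather than
on a model.  Proof: normalise the given `1`-handlebody (NORM,
`exists_hasHandleDecomposition_handleCount_one_holds`), write `z = b.incl z₁`, obtain Lemma 2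
at `(b, z₁)` (`forall_isRealisedByExtendable_of_realise_diffeomorph`) and move the base point
(`laudenbachPoenaru_lemma2_transport` with `φ = id`; the boundary is connected,
`connectedSpace_boundary_of_isHandlebodyOfIndexLE_one_holds`).  No use is made of L1/UNIQ₄.
[cite: LaudenbachPoenaruBSMF1972, §2, Lemma 2 and its proof (pp. 339–340)] -/
theorem laudenbachPoenaru_exists_diffeoExtends_mapOfEq_eq_of_forall_realise
    (H : ∀ (k : ℕ) (V : Type u) [TopologicalSpace V] [T2Space V] [SecondCountableTopology V]
      [CompactSpace V] [ConnectedSpace V] [ChartedSpace (EuclideanHalfSpace 4) V]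
      [IsManifold (𝓡∂ 4) ∞ V],
      HasHandleDecomposition 3 V (handleCount 1 k) → IsOrientable (𝓡∂ 4) V →
      ∃ (z : V) (_ : z ∈ (𝓡∂ 4).boundary V) (e : FundamentalGroup V z ≃* FreeGroup (Fin k))
        (S : Set (MulAut (FreeGroup (Fin k)))), Subgroup.closure S = ⊤ ∧
        ∀ ν ∈ S, ∃ (G : V ≃ₘ⟮𝓡∂ 4, 𝓡∂ 4⟯ V) (hGz : G z = z),
          ∀ c : FundamentalGroup V z,
            FundamentalGroup.mapOfEq (⟨G, G.continuous⟩ : C(V, V)) hGz c = e.symm (ν (e c))) :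
    laudenbachPoenaru_exists_diffeoExtends_mapOfEq_eq.{u} := by
  intro V _ _ _ _ _ _ _ hV ho b z₀ θ
  obtain ⟨k, hk⟩ := exists_hasHandleDecomposition_handleCount_one_holds V hV
  obtain ⟨z, hz, e, S, hS, hreal⟩ := H k V hk ho
  haveI : ConnectedSpace b.carrier :=
    connectedSpace_boundary_of_isHandlebodyOfIndexLE_one_holds V hV ho b
  -- `z = b.incl z₁`
  have hz' : z ∈ range b.incl := b.range_incl ▸ hz
  obtain ⟨z₁, rfl⟩ := hz'
  -- Lemma 2 at `(b, z₁)`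
  have hL : ∀ θ₁ : FundamentalGroup b.carrier z₁ ≃* FundamentalGroup b.carrier z₁,
      ∃ χ : b.carrier ≃ₘ⟮𝓡 3, 𝓡 3⟯ b.carrier, b.DiffeoExtends χ ∧ ∃ hz : χ z₁ = z₁,
        ∀ a : FundamentalGroup b.carrier z₁,
          FundamentalGroup.mapOfEq (⟨χ, χ.continuous⟩ : C(b.carrier, b.carrier)) hz a = θ₁ a :=
    fun θ₁ => forall_isRealisedByExtendable_of_realise_diffeomorph hk b z₁ e hS hreal θ₁
  -- move the base point to `z₀`
  exact laudenbachPoenaru_lemma2_transport (Diffeomorph.refl (𝓡∂ 4) V ∞) b z₁ hL b z₀ θ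

/-- **h₁ from the elementary Nielsen moves realised on every decomposed `1`-handlebody.**  The
same with `S =` the `k²` elementary Nielsen automorphisms `xᵢ ↦ xᵢ⁻¹`, `xᵢ ↦ xᵢ xⱼ` (`j ≠ i`) of
`F_k = F(x₀, …, x_{k-1})` (`nielsenGenerators k`), which generate `Aut F_k` by Nielsen's
theorem (proved: `autFreeGroup_eq_closure_nielsen_holds`): it suffices that on every compact
connected orientable `V` with one `0`-handle and `k` `1`-handles, in some basis
`e : π₁(V, z) ≅ F_k` at some boundary point `z`, each of these moves is induced by a
self-diffeomorphism of `V` fixing `z` — Laudenbach–Poénaru's `H₂` ("flip handle `i`") and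
`H₃` ("slide handle `i` over handle `j`", p. 340), for all `i ≠ j`, their `H₁` (transpositions)
being then superfluous. [cite: LaudenbachPoenaruBSMF1972, §2, proof of Lemma 2 (pp. 339–340)]
[cite: Johnson1997, Ch. 3 §4 Cor. 7] -/
theorem laudenbachPoenaru_exists_diffeoExtends_mapOfEq_eq_of_forall_realise_nielsen
    (H : ∀ (k : ℕ) (V : Type u) [TopologicalSpace V] [T2Space V] [SecondCountableTopology V]
      [CompactSpace V] [ConnectedSpace V] [ChartedSpace (EuclideanHalfSpace 4) V]
      [IsManifold (𝓡∂ 4) ∞ V],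
      HasHandleDecomposition 3 V (handleCount 1 k) → IsOrientable (𝓡∂ 4) V →
      ∃ (z : V) (_ : z ∈ (𝓡∂ 4).boundary V) (e : FundamentalGroup V z ≃* FreeGroup (Fin k)),
        ∀ ν ∈ nielsenGenerators k, ∃ (G : V ≃ₘ⟮𝓡∂ 4, 𝓡∂ 4⟯ V) (hGz : G z = z),
          ∀ c : FundamentalGroup V z,
            FundamentalGroup.mapOfEq (⟨G, G.continuous⟩ : C(V, V)) hGz c = e.symm (ν (e c))) :
    laudenbachPoenaru_exists_diffeoExtends_mapOfEq_eq.{u} := by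
  refine laudenbachPoenaru_exists_diffeoExtends_mapOfEq_eq_of_forall_realise
    fun k V _ _ _ _ _ _ _ hk ho => ?_
  obtain ⟨z, hz, e, hreal⟩ := H k V hk ho
  exact ⟨z, hz, e, nielsenGenerators k,
    (autFreeGroup_eq_closure_nielsen_iff.1 autFreeGroup_eq_closure_nielsen_holds) k, hreal⟩

/-- **Boundary form of the same reduction** (the format of REALISE,
`exists_oneHandlebody_realise_laudenbachPoenaruGenerators`, but on every decomposed `V` instead
of one model per `k`): h₁ holds as soon as every compact connected orientable `V` with one
`0`-handle and `k` `1`-handles has *some* boundary datum `b₀`, base point `z₀ ∈ b₀.carrier`,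
isomorphism `e : π₁(b₀.carrier, z₀) ≅ F_k` and generating set `S` of `Aut F_k` with every
`e⁻¹ ν e`, `ν ∈ S`, realised by an extendable based self-diffeomorphism of `b₀.carrier`
(`BoundaryData.forall_isRealisedByExtendable_of_closure_eq_top_freeGroup` and
`laudenbachPoenaru_lemma2_transport` with `φ = id`; again no L1/UNIQ₄).
[cite: LaudenbachPoenaruBSMF1972, §2, Lemma 2 and its proof (pp. 339–340)] -/
theorem laudenbachPoenaru_exists_diffeoExtends_mapOfEq_eq_of_forall_realise_boundary
    (H : ∀ (k : ℕ) (V : Type u) [TopologicalSpace V] [T2Space V] [SecondCountableTopology V]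
      [CompactSpace V] [ConnectedSpace V] [ChartedSpace (EuclideanHalfSpace 4) V]
      [IsManifold (𝓡∂ 4) ∞ V],
      HasHandleDecomposition 3 V (handleCount 1 k) → IsOrientable (𝓡∂ 4) V →
      ∃ (b₀ : BoundaryData (𝓡∂ 4) V (𝓡 3)) (z₀ : b₀.carrier)
        (e : FundamentalGroup b₀.carrier z₀ ≃* FreeGroup (Fin k))
        (S : Set (MulAut (FreeGroup (Fin k)))), Subgroup.closure S = ⊤ ∧
        ∀ ν ∈ S, b₀.IsRealisedByExtendable z₀ (fun a => e.symm (ν (e a)))) :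
    laudenbachPoenaru_exists_diffeoExtends_mapOfEq_eq.{u} := by
  intro V _ _ _ _ _ _ _ hV ho b z θ
  obtain ⟨k, hk⟩ := exists_hasHandleDecomposition_handleCount_one_holds V hV
  obtain ⟨b₀, z₀, e, S, hS, hreal⟩ := H k V hk ho
  haveI : ConnectedSpace b₀.carrier :=
    connectedSpace_boundary_of_isHandlebodyOfIndexLE_one_holds V hV ho b₀
  have hL₀ : ∀ θ₀ : FundamentalGroup b₀.carrier z₀ ≃* FundamentalGroup b₀.carrier z₀,
      ∃ χ₀ : b₀.carrier ≃ₘ⟮𝓡 3, 𝓡 3⟯ b₀.carrier, b₀.DiffeoExtends χ₀ ∧ ∃ hz : χ₀ z₀ = z₀,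
        ∀ a : FundamentalGroup b₀.carrier z₀,
          FundamentalGroup.mapOfEq (⟨χ₀, χ₀.continuous⟩ : C(b₀.carrier, b₀.carrier)) hz a = θ₀ a :=
    fun θ₀ => BoundaryData.forall_isRealisedByExtendable_of_closure_eq_top_freeGroup e hS hreal θ₀
  exact laudenbachPoenaru_lemma2_transport (Diffeomorph.refl (𝓡∂ 4) V ∞) b₀ z₀ hL₀ b z θ

end Direct

end Literature.Topology.FourManifolds
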